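import Mathlib

/-!
# Imbrie (2016), §2.2: the first-step COUNTING sentence — admissible commutator sequences number at most (n+2)!/2,
and the resulting per-order factor (n+1)(n+2)/2 · (2γ/ε)ⁿ sums geometrically — REPRODUCTION (kernel-checked)

CITATION HEADER (lean-in-tree rule 2026-08-18). J. Z. Imbrie, *On many-body localization for quantum spin chains*, J. Stat. Phys.
**163** (2016) 998–1048, doi 10.1007/s10955-016-1508-x, arXiv:1403.7837 [ImbrieJSP2016], §2.2, verbatim (display (2.8) and the
sentences after it): "(ad A)ⁿ J^{(0)per} = Σ_{i_0,i_1,…,i_n} (ad A(i_n)) ⋯ (ad A(i_1)) J^{(0)}(i_0). We must have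
dist(i_p, {i_0,…,i_{p−1}}) ≤ 1; otherwise the commutator with A(i_p) vanishes. Note that the number of choices for i_p, given
i_0,…,i_{p−1}, is no greater than p + 2. Thus we have, in effect, a combinatoric factor (n+2)!/2! which is controlled by the
prefactors n/(n+1)! or 1/n!, leaving only a factor (n+1)(n+2). There are 2ⁿ terms from writing out an n-th order commutator, so
the series is geometrically convergent." and (2.10) with the sentence after it: "|J^{(1)}_{σσ̃}(g_1)| ≤ γ(γ/ε)^{|g_1|−1}/(|g_1|−1)!
… the sum over g_1 involving a particular J^{(0)}(i_0) converges geometrically as γ(cγ/ε)ⁿ."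
WHAT IS REPRODUCED (exactly, as finite combinatorics + one scalar series; no operator algebra): (1) `AdmFrom S l` = the paper's
admissibility of a sequence of sites l = [i_1,…,i_n] given the visited set S (initially {i_0}); (2) every admissible sequence lies in
an explicitly enumerated finset `admLists` driven by the min/max of the visited sites, whose cardinality is ≤ (w+3)(w+4)⋯(w+n+2)
for visited width w — for w = 0 this is 3·4⋯(n+2) = (n+2)!/2!, the paper's count ("no greater than p + 2 choices" is the interval
[min−1, max+1], and the width grows by at most one per step); hence ANY finite set of admissible length-n sequences from i_0 has at
most (n+2)!/2 elements (`two_mul_card_admissible_le`); (3) the scalar bookkeeping of the same sentence: with ≤ (n+2)!/2 sequences,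
2ⁿ commutator terms, the prefactor 1/n! ≥ n/(n+1)! and matrix elements ≤ γ(γ/ε)ⁿ, the order-n total is γ·C(n+2,2)·(2γ/ε)ⁿ and
Σ_n C(n+2,2) yⁿ = (1−y)^{−3} for 0 ≤ y < 1 (`step1_total_hasSum`): geometric convergence with the explicit constant c = 2, i.e.
whenever 2γ/ε < 1 (with ε = γ^{1/20}: γ^{19/20} < 1/2).  WHAT IS NOT CLAIMED: nothing about the operators A, J, the bound (2.10)
itself (an analytic estimate on matrix elements, taken here as the per-graph weight), later steps, or §4.2.1's multiscale counting;
this is the step-1 instance of "exponentially many terms versus the small parameter" discussed in the audit cell's SURVIVAL.md §4E′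
(W1), now kernel-checked in its counting and series parts. Audit cell `pub-imbrie`, unit b2b-imbrie-2 gen 3 (build tag b2b).
-/

namespace Literature.MathematicalPhysics.QuantumLattice.Imbrie2016

open Finset

/-- Admissibility of a commutator sequence (Imbrie 2016, §2.2, sentence after (2.8)): given the set `S` of sites already present
(initially `{i₀}`, the site of `J^{(0)}(i₀)`), the next site must lie within distance 1 of `S` — "We must have
dist(i_p, {i_0,…,i_{p−1}}) ≤ 1; otherwise the commutator with A(i_p) vanishes" — and is then added to `S`.
[cite: ImbrieJSP2016, §2.2 after eq. (2.8)] -/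
def AdmFrom : Finset ℤ → List ℤ → Prop
  | _, [] => True
  | S, i :: t => (∃ j ∈ S, |i - j| ≤ 1) ∧ AdmFrom (insert i S) t

/-- `AdmFrom` is the paper's condition verbatim: for every position p, the site l[p] is within distance 1 of S ∪ {l[0],…,l[p−1]}
("dist(i_p, {i_0,…,i_{p−1}}) ≤ 1" with S = {i_0}). [cite: ImbrieJSP2016, §2.2 after eq. (2.8)] -/
theorem admFrom_iff (S : Finset ℤ) (l : List ℤ) :
    AdmFrom S l ↔ ∀ (p : ℕ) (hp : p < l.length), ∃ j ∈ S ∪ (l.take p).toFinset, |l[p] - j| ≤ 1 := by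
  induction l generalizing S with
  | nil => simp [AdmFrom]
  | cons i t ih =>
    simp only [AdmFrom, ih, List.length_cons]
    constructor
    · rintro ⟨h0, ht⟩ p hp
      rcases p with _ | q
      · simpa using h0
      · have hq : q < t.length := by omega
        obtain ⟨j, hj, hdist⟩ := ht q hq
        refine ⟨j, ?_, by simpa using hdist⟩
        simp only [List.take_succ_cons, List.toFinset_cons, Finset.mem_union, Finset.mem_insert] at hj ⊢
        tauto
    · intro h
      refine ⟨by simpa using h 0 (by omega), fun q hq => ?_⟩
      obtain ⟨j, hj, hdist⟩ := h (q + 1) (by omega)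
      refine ⟨j, ?_, by simpa using hdist⟩
      simp only [List.take_succ_cons, List.toFinset_cons, Finset.mem_union, Finset.mem_insert] at hj ⊢
      tauto

/-- Explicit enumeration of candidate sequences of length `n`, driven only by the current minimum `lo` and maximum `hi` of the
visited sites: the next site ranges over the integer interval [lo − 1, hi + 1] ("no greater than p + 2" choices when hi − lo ≤ p − 1).
[cite: ImbrieJSP2016, §2.2 after eq. (2.8)] -/
noncomputable def admLists : ℤ → ℤ → ℕ → Finset (List ℤ)
  | _, _, 0 => {[]}
  | a, b, n + 1 => (Finset.Icc (a - 1) (b + 1)).biUnion fun i => (admLists (min i a) (max i b) n).image (List.cons i)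

/-- Every admissible sequence is enumerated by `admLists (min S) (max S)`. [cite: ImbrieJSP2016, §2.2 after eq. (2.8)] -/
theorem mem_admLists_of_admFrom {S : Finset ℤ} (hS : S.Nonempty) {l : List ℤ} (h : AdmFrom S l) :
    l ∈ admLists (S.min' hS) (S.max' hS) l.length := by
  induction l generalizing S with
  | nil => simp [admLists]
  | cons i t ih =>
    simp only [AdmFrom] at h
    obtain ⟨⟨j, hjS, hij⟩, ht⟩ := h
    rw [abs_le] at hij
    have hlo : S.min' hS ≤ j := S.min'_le j hjS
    have hhi : j ≤ S.max' hS := S.le_max' j hjS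
    simp only [admLists, List.length_cons, Finset.mem_biUnion, Finset.mem_image, Finset.mem_Icc]
    refine ⟨i, ⟨by linarith, by linarith⟩, t, ?_, rfl⟩
    have := ih (S.insert_nonempty i) ht
    rwa [Finset.min'_insert, Finset.max'_insert] at this

/-- The count: with visited width `hi − lo`, the number of enumerated continuations of length `n` is at most
(w+3)(w+4)⋯(w+n+2) = (w+3).ascFactorial n, because the interval [lo−1, hi+1] has w + 3 points and the width grows by at most one
per step ("the number of choices for i_p, given i_0,…,i_{p−1}, is no greater than p + 2"). [cite: ImbrieJSP2016, §2.2 after eq. (2.8)] -/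
theorem card_admLists_le (a b : ℤ) (hle : a ≤ b) (n : ℕ) :
    (admLists a b n).card ≤ ((b - a).toNat + 3).ascFactorial n := by
  induction n generalizing a b with
  | zero => simp [admLists]
  | succ n ih =>
    have hIcc : (Finset.Icc (a - 1) (b + 1)).card = (b - a).toNat + 3 := by
      rw [Int.card_Icc]; omega
    calc (admLists a b (n + 1)).card
        ≤ (Finset.Icc (a - 1) (b + 1)).card * (((b - a).toNat + 3 + 1).ascFactorial n) := by
          simp only [admLists]
          apply Finset.card_biUnion_le_card_mul
          intro i b'
          rw [Finset.mem_Icc] at b'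
          calc ((admLists (min i a) (max i b) n).image (List.cons i)).card
              ≤ (admLists (min i a) (max i b) n).card := Finset.card_image_le
            _ ≤ ((max i b - min i a).toNat + 3).ascFactorial n :=
                ih _ _ (le_trans (min_le_right _ _) (le_trans hle (le_max_right _ _)))
            _ ≤ ((b - a).toNat + 3 + 1).ascFactorial n := by
                apply Nat.ascFactorial_le
                have h1 : max i b - min i a ≤ b - a + 1 := by
                  rcases le_total i a with h | h <;> rcases le_total i b with h' | h' <;>
                    simp [h, h'] <;> linarith
                omega
      _ = ((b - a).toNat + 3) * (((b - a).toNat + 3 + 1).ascFactorial n) := by rw [hIcc]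
      _ = ((b - a).toNat + 3).ascFactorial (n + 1) := by
          rw [Nat.succ_ascFactorial, Nat.ascFactorial_succ]

/-- **The paper's count, kernel-checked**: any finite set of admissible sequences (i_1,…,i_n) issuing from i_0 has at most
(n+2)!/2! = 3·4⋯(n+2) elements. [cite: ImbrieJSP2016, §2.2 after eq. (2.8)] -/
theorem two_mul_card_admissible_le (i₀ : ℤ) (n : ℕ) (T : Finset (List ℤ))
    (hT : ∀ l ∈ T, l.length = n ∧ AdmFrom {i₀} l) : 2 * T.card ≤ (n + 2).factorial := by
  have hsub : T ⊆ admLists i₀ i₀ n := by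
    intro l hl
    obtain ⟨hlen, hadm⟩ := hT l hl
    have := mem_admLists_of_admFrom (Finset.singleton_nonempty i₀) hadm
    simpa [hlen] using this
  have h1 : T.card ≤ (admLists i₀ i₀ n).card := Finset.card_le_card hsub
  have h2 : (admLists i₀ i₀ n).card ≤ (3 : ℕ).ascFactorial n := by
    simpa using card_admLists_le i₀ i₀ le_rfl n
  have h3 : 2 * (3 : ℕ).ascFactorial n = (n + 2).factorial := by
    have h := Nat.factorial_mul_ascFactorial 2 n
    rw [Nat.factorial_two, Nat.add_comm 2 n] at h
    exact h
  calc 2 * T.card ≤ 2 * (3 : ℕ).ascFactorial n := by omega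
    _ = (n + 2).factorial := h3

/-- The same as a statement about the SET of admissible length-n sequences from i₀: it is finite with at most (n+2)!/2 elements.
[cite: ImbrieJSP2016, §2.2 after eq. (2.8)] -/
theorem two_mul_ncard_admissible_le (i₀ : ℤ) (n : ℕ) :
    2 * {l : List ℤ | l.length = n ∧ AdmFrom {i₀} l}.ncard ≤ (n + 2).factorial := by
  have hsub : {l : List ℤ | l.length = n ∧ AdmFrom {i₀} l} ⊆ ↑(admLists i₀ i₀ n) := by
    intro l hl
    obtain ⟨hlen, hadm⟩ := hl
    have := mem_admLists_of_admFrom (Finset.singleton_nonempty i₀) hadm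
    simpa [hlen] using this
  have hfin : {l : List ℤ | l.length = n ∧ AdmFrom {i₀} l}.Finite := (Finset.finite_toSet _).subset hsub
  obtain ⟨T, hT⟩ := hfin.exists_finset_coe
  have hmem : ∀ l ∈ T, l.length = n ∧ AdmFrom {i₀} l := by
    intro l hl
    have : l ∈ (↑T : Set (List ℤ)) := hl
    rw [hT] at this
    exact this
  have := two_mul_card_admissible_le i₀ n T hmem
  rwa [← hT, Set.ncard_coe_finset]

/-- The scalar bookkeeping of the sentence "(n+2)!/2! … controlled by the prefactors n/(n+1)! or 1/n!, leaving only a factor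
(n+1)(n+2)": (n+2)! = C(n+2, 2) · 2! · n!, i.e. ((n+2)!/2)/n! = (n+1)(n+2)/2. [cite: ImbrieJSP2016, §2.2 after eq. (2.8)] -/
theorem factorial_add_two_eq (n : ℕ) : (n + 2).factorial = (n + 2).choose 2 * 2 * n.factorial := by
  have h := Nat.choose_mul_factorial_mul_factorial (show 2 ≤ n + 2 by omega)
  simp only [Nat.add_sub_cancel, Nat.factorial_two] at h
  rw [← h]

/-- n/(n+1)! ≤ 1/n! (the prefactor of the (ad A)ⁿ J^{(0)per} term is no larger than that of (ad A)ⁿ J^{(0)res}).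
[cite: ImbrieJSP2016, §2.2 eq. (2.7)] -/
theorem prefactor_le (n : ℕ) : (n : ℝ) / (n + 1).factorial ≤ 1 / n.factorial := by
  rw [Nat.factorial_succ, Nat.cast_mul, div_le_div_iff₀ (by positivity) (by positivity)]
  have : (n : ℝ) ≤ n + 1 := by linarith
  push_cast
  nlinarith [show (0 : ℝ) < n.factorial by positivity]

/-- **Geometric convergence with the explicit constant c = 2** ("There are 2ⁿ terms from writing out an n-th order commutator, so
the series is geometrically convergent … converges geometrically as γ(cγ/ε)ⁿ"): the order-n total
[(n+2)!/2 sequences] × [2ⁿ commutator terms] × [prefactor 1/n!] × [matrix elements γ(γ/ε)ⁿ] equals γ·C(n+2,2)·(2γ/ε)ⁿ, and these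
sum to γ/(1 − 2γ/ε)³ whenever 0 < ε and 0 ≤ 2γ/ε < 1. [cite: ImbrieJSP2016, §2.2 eq. (2.10)] -/
theorem step1_total_hasSum {γ ε : ℝ} (hγ : 0 ≤ γ) (hε : 0 < ε) (hsmall : 2 * γ / ε < 1) :
    HasSum (fun n : ℕ => ((n + 2).factorial / 2 : ℝ) * 2 ^ n * (1 / n.factorial) * (γ * (γ / ε) ^ n))
      (γ / (1 - 2 * γ / ε) ^ 3) := by
  have hr : ‖(2 * γ / ε : ℝ)‖ < 1 := by
    rw [Real.norm_eq_abs, abs_of_nonneg (by positivity)]; exact hsmall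
  have H := (hasSum_choose_mul_geometric_of_norm_lt_one 2 hr).mul_left γ
  have e : ∀ n : ℕ, ((n + 2).factorial / 2 : ℝ) * 2 ^ n * (1 / n.factorial) * (γ * (γ / ε) ^ n)
      = γ * (((n + 2).choose 2 : ℕ) * (2 * γ / ε) ^ n) := by
    intro n
    have hf : ((n + 2).factorial : ℝ) = ((n + 2).choose 2 : ℕ) * 2 * n.factorial := by
      exact_mod_cast factorial_add_two_eq n
    have hn : (n.factorial : ℝ) ≠ 0 := by positivity
    rw [hf]
    field_simp
    ring
  rw [funext e, show γ / (1 - 2 * γ / ε) ^ 3 = γ * (1 / (1 - 2 * γ / ε) ^ (2 + 1)) by ring]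
  exact H

end Literature.MathematicalPhysics.QuantumLattice.Imbrie2016
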